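import Summits.Langlands.Langlands.Theses.LieDefectSplit

/-!
# Route LieDefectSplit — Assembly

The assembly item (stmt-Langlands-28419) of the child route `LieDefectSplit` (decomp-langlands lens-5 gen 12; refines the declared
residual RSL = `CoreAdequacySplit.NoAdequateLayerLifting`, stmt-Langlands-27954, of route-Langlands-CoreAdequacySplit) for the Langlands summit:
`LieObstructedLifting → DegenerateLayerLifting → SolvableDescentTransport → OdlyzkoWorldAutomorphy → TransOdlyzkoAutomorphy →
SatakeAvatarExistence → SolvableAscentConstituent → CliffordSolvableDescent → AdequateImageLifting → SolvableAdequacyTransport →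
NoAdequateLayerFrame → Langlands`.

This is literally the type of the route file's sorry-free deciding theorem `Summit.Langlands.Langlands.Theses.LieDefectSplit.closes`
(glue = node `closes_framed`: RSL ⟸ LIE ∧ DEG ∧ SBL↓ by two excluded middles, SBL↓ from TRANS↓ and the parent's seven binders, then FRAME′).
Nothing here proves `Langlands`: the assembly records only that the eleven ledger items of the route, taken together, imply the summit statement.
-/

set_option linter.dupNamespace false -- project-wide option (lakefile weak.linter.dupNamespace); `Summit.Langlands.Langlands` is the mandated namespace

namespace Summit.Langlands.Langlands.Theorems

/-- **Assembly of route LieDefectSplit** (stmt-Langlands-28419): `LIE → DEG → TRANS↓ → OW → TOA → W⁺ → AUT↑ → CSD → AIL → TRANS → FRAME′ →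
Langlands`.  Proof: unfold `Assembly` and apply the route's deciding theorem `Theses.LieDefectSplit.closes`. -/
theorem lieDefectSplit_assembly_proof :
    Summit.Langlands.Langlands.Theses.LieDefectSplit.Assembly := by
  unfold Summit.Langlands.Langlands.Theses.LieDefectSplit.Assembly
  exact Summit.Langlands.Langlands.Theses.LieDefectSplit.closes

end Summit.Langlands.Langlands.Theorems
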